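import Summits.NavierStokesRegularity.FunctionalMining.PalinstrophyLadderProofs
import Summits.NavierStokesRegularity.FunctionalMining.NoGo.PalinstrophySupRateRefutation
import Literature.Analysis.FluidPDE.TorusPalinstrophyLadder
import Literature.Analysis.FunctionSpaces.TorusEnstrophyOrthogonality
import Mathlib.MeasureTheory.Integral.Bochner.Basic
import HarnessLib

/-!
# Palinstrophy production in strain currency, I: pointwise trace-free Cauchy–Schwarz and the Leibniz pieces

Search for candidate a priori estimates; no regularity claim. Part 1/3 of the no-go seat's staged
`NoGo/PalinstrophyStrainTransport.STAGING.lean` v2.1 (cell `pub-nsfunc`, gen 5; split by the prove seat for the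
400-line cap at the file's own section boundaries, text otherwise verbatim). This part: namespace `StrainTransport`
(pointwise linear algebra on `3 × 3` arrays: only the trace-free Hessian pairs with the strain) and the two surviving
Leibniz pieces of `Δ((u·∇)u)` in strain currency. The theorem `|N(v)| ≤ √6·sup|S|_F·𝒫(v)` is in part 2
(`NoGo/PalinstrophyStrainTransport.lean`), the `√6` ladder constant in part 3 (`NoGo/PalinstrophyStrainLadder.lean`).
Folklore calculus; nothing is asserted about Navier–Stokes.
-/

noncomputable section

open MeasureTheory Set Finset Real
open scoped InnerProductSpace RealInnerProductSpace

namespace Summit.NavierStokesRegularity.FunctionalMining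

open Literature.Analysis.FunctionSpaces Literature.Analysis.FluidPDE

variable {d : Type*} [Fintype d] [DecidableEq d]

/-! ## Pointwise linear algebra: trace-free Cauchy–Schwarz on `3 × 3` arrays -/

namespace StrainTransport

/-- **Trace-free Cauchy–Schwarz.** For arrays `S, H : d × d → ℝ` over a `3`-element index type with
`Σᵢ Sᵢᵢ = 0`: `⟨S, H⟩² ≤ |S|² (|H|² − (tr H)²/3)` — pair `S` with the deviator `H − (tr H/3) I`.
[folklore] -/
theorem sum_mul_sq_le_traceFree (hd : Fintype.card d = 3) (S H : d → d → ℝ)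
    (htr : ∑ i, S i i = 0) :
    (∑ i, ∑ j, S i j * H i j) ^ 2 ≤
      (∑ i, ∑ j, S i j ^ 2) * ((∑ i, ∑ j, H i j ^ 2) - (∑ i, H i i) ^ 2 / 3) := by
  set t : ℝ := ∑ i, H i i with ht
  have h1 : ∑ i, ∑ j, S i j * H i j = ∑ i, ∑ j, S i j * (H i j - if i = j then t / 3 else 0) := by
    have e : ∀ i, ∑ j, S i j * (H i j - if i = j then t / 3 else 0) =
        (∑ j, S i j * H i j) - S i i * (t / 3) := by
      intro i
      simp only [mul_sub, Finset.sum_sub_distrib, mul_ite, mul_zero, Finset.sum_ite_eq,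
        Finset.mem_univ, if_true]
    simp only [e, Finset.sum_sub_distrib, ← Finset.sum_mul, htr, zero_mul, sub_zero]
  have h2 : ∑ i, ∑ j, (H i j - if i = j then t / 3 else 0) ^ 2 =
      (∑ i, ∑ j, H i j ^ 2) - t ^ 2 / 3 := by
    have e : ∀ i, ∑ j, (H i j - if i = j then t / 3 else 0) ^ 2 =
        (∑ j, H i j ^ 2) - 2 * (t / 3) * H i i + (t / 3) ^ 2 := by
      intro i
      have e' : ∀ j, (H i j - if i = j then t / 3 else 0) ^ 2 =
          H i j ^ 2 - 2 * (t / 3) * (if i = j then H i j else 0) +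
            (if i = j then (t / 3) ^ 2 else 0) := by
        intro j; split_ifs <;> ring
      simp only [e', Finset.sum_add_distrib, Finset.sum_sub_distrib, ← Finset.mul_sum,
        Finset.sum_ite_eq, Finset.mem_univ, if_true]
    simp only [e, Finset.sum_add_distrib, Finset.sum_sub_distrib, ← Finset.mul_sum,
      Finset.sum_const, Finset.card_univ, hd, ← ht, nsmul_eq_mul, Nat.cast_ofNat]
    ring
  have hCS : (∑ i, ∑ j, S i j * (H i j - if i = j then t / 3 else 0)) ^ 2 ≤
      (∑ i, ∑ j, S i j ^ 2) * ∑ i, ∑ j, (H i j - if i = j then t / 3 else 0) ^ 2 := by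
    have h := Finset.sum_mul_sq_le_sq_mul_sq (Finset.univ : Finset (d × d)) (fun p => S p.1 p.2)
      (fun p => H p.1 p.2 - if p.1 = p.2 then t / 3 else 0)
    simpa only [Fintype.sum_prod_type] using h
  rw [h1, ← h2]
  exact hCS

/-- **Deviatoric bound for a quadratic form**: for a trace-free array `S` on a `3`-element index type
with `|S|² ≤ M²` (`M ≥ 0`) and any `w`: `|wᵀ S w| ≤ (√6/3) · M · |w|²` (`= √(2/3) M|w|²`). [folklore] -/
theorem abs_quadForm_le (hd : Fintype.card d = 3) (S : d → d → ℝ) (htr : ∑ i, S i i = 0)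
    (w : d → ℝ) {M : ℝ} (hM : 0 ≤ M) (hS : ∑ i, ∑ j, S i j ^ 2 ≤ M ^ 2) :
    |∑ i, ∑ j, S i j * (w i * w j)| ≤ Real.sqrt 6 / 3 * M * ∑ i, w i ^ 2 := by
  have hTF := sum_mul_sq_le_traceFree hd S (fun i j => w i * w j) htr
  have hn : ∑ i, ∑ j, (w i * w j) ^ 2 = (∑ i, w i ^ 2) ^ 2 := by
    rw [sq (∑ i, w i ^ 2), Finset.sum_mul_sum]
    exact Finset.sum_congr rfl fun i _ => Finset.sum_congr rfl fun j _ => by ring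
  have hdiag : ∑ i, w i * w i = ∑ i, w i ^ 2 := Finset.sum_congr rfl fun i _ => by ring
  simp only [hn, hdiag] at hTF
  set n2 := ∑ i, w i ^ 2 with hn2
  have h6 : Real.sqrt 6 ^ 2 = 6 := Real.sq_sqrt (by norm_num)
  have hn20 : 0 ≤ n2 := Finset.sum_nonneg fun i _ => sq_nonneg _
  have hb0 : 0 ≤ Real.sqrt 6 / 3 * M * n2 := by positivity
  refine abs_le_of_sq_le_sq ?_ hb0
  calc (∑ i, ∑ j, S i j * (w i * w j)) ^ 2 ≤ (∑ i, ∑ j, S i j ^ 2) * (n2 ^ 2 - n2 ^ 2 / 3) := hTF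
    _ ≤ M ^ 2 * (n2 ^ 2 - n2 ^ 2 / 3) :=
        mul_le_mul_of_nonneg_right hS (by nlinarith [sq_nonneg n2])
    _ = (Real.sqrt 6 / 3 * M * n2) ^ 2 := by rw [mul_pow, mul_pow, div_pow, h6]; ring

/-- **Deviatoric bound for the Hessian piece**: for a trace-free array `S` (`|S|² ≤ M²`, `M ≥ 0`), a
family of arrays `H^{(j)}ₘᵢ = Hc i m j` whose traces are `wⱼ` (`Σₘ Hc m m j = w j`):
`2 |Σⱼ wⱼ ⟨S, H^{(j)}⟩| ≤ M · ((√6/3)|w|² + (√6/2)(Σ|H^{(j)}|² − |w|²/3))`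
(trace-free Cauchy–Schwarz per `j`, Cauchy–Schwarz in `j`, then `2√(AB) ≤ tA + B/t` with
`t = √6/3`). [folklore] -/
theorem two_mul_abs_bilin_le (hd : Fintype.card d = 3) (S : d → d → ℝ) (htr : ∑ i, S i i = 0)
    (Hc : d → d → d → ℝ) (w : d → ℝ) (hlap : ∀ j, ∑ m, Hc m m j = w j) {M : ℝ} (hM : 0 ≤ M)
    (hS : ∑ i, ∑ j, S i j ^ 2 ≤ M ^ 2) :
    2 * |∑ j, w j * ∑ m, ∑ i, S m i * Hc i m j| ≤
      M * (Real.sqrt 6 / 3 * (∑ j, w j ^ 2) +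
        Real.sqrt 6 / 2 * ((∑ m, ∑ i, ∑ j, Hc i m j ^ 2) - (∑ j, w j ^ 2) / 3)) := by
  set n2 := ∑ j, w j ^ 2 with hn2
  set G2 := ∑ m, ∑ i, ∑ j, Hc i m j ^ 2 with hG2
  -- per-component trace-free Cauchy–Schwarz
  have hcj : ∀ j, (∑ m, ∑ i, S m i * Hc i m j) ^ 2 ≤
      (∑ m, ∑ i, S m i ^ 2) * ((∑ m, ∑ i, Hc i m j ^ 2) - w j ^ 2 / 3) := by
    intro j
    have h := sum_mul_sq_le_traceFree hd S (fun m i => Hc i m j) htr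
    simp only [hlap j] at h
    exact h
  have hsumc : ∑ j, (∑ m, ∑ i, S m i * Hc i m j) ^ 2 ≤ (∑ m, ∑ i, S m i ^ 2) * (G2 - n2 / 3) := by
    calc ∑ j, (∑ m, ∑ i, S m i * Hc i m j) ^ 2
        ≤ ∑ j, (∑ m, ∑ i, S m i ^ 2) * ((∑ m, ∑ i, Hc i m j ^ 2) - w j ^ 2 / 3) :=
          Finset.sum_le_sum fun j _ => hcj j
      _ = (∑ m, ∑ i, S m i ^ 2) * (G2 - n2 / 3) := by
          rw [← Finset.mul_sum, Finset.sum_sub_distrib, ← Finset.sum_div, hG2, hn2]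
          congr 2
          rw [Finset.sum_comm]
          exact Finset.sum_congr rfl fun m _ => Finset.sum_comm
  -- the deviator has nonnegative norm: `|w|² ≤ 3 Σₘ |H^{(·)}ₘₘ|² ≤ 3 G2`
  have hD0 : 0 ≤ G2 - n2 / 3 := by
    have h1 : ∀ j, w j ^ 2 ≤ 3 * ∑ m, Hc m m j ^ 2 := by
      intro j
      rw [← hlap j]
      have h := Finset.sum_mul_sq_le_sq_mul_sq Finset.univ (fun _ : d => (1 : ℝ)) (fun m => Hc m m j)
      simpa only [one_mul, one_pow, Finset.sum_const, Finset.card_univ, hd, nsmul_eq_mul,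
        Nat.cast_ofNat, mul_one] using h
    have h2 : ∀ m j, Hc m m j ^ 2 ≤ ∑ i, Hc i m j ^ 2 := fun m j =>
      Finset.single_le_sum (f := fun i => Hc i m j ^ 2) (fun i _ => sq_nonneg _) (Finset.mem_univ m)
    have h3 : n2 ≤ 3 * G2 := by
      calc n2 = ∑ j, w j ^ 2 := hn2
        _ ≤ ∑ j, 3 * ∑ m, Hc m m j ^ 2 := Finset.sum_le_sum fun j _ => h1 j
        _ = 3 * ∑ m, ∑ j, Hc m m j ^ 2 := by rw [← Finset.mul_sum, Finset.sum_comm]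
        _ ≤ 3 * G2 := by
            rw [hG2]
            refine mul_le_mul_of_nonneg_left (Finset.sum_le_sum fun m _ => ?_) (by norm_num)
            rw [Finset.sum_comm]
            exact Finset.sum_le_sum fun j _ => h2 m j
    linarith
  -- Cauchy–Schwarz in `j`
  have hP : (∑ j, w j * ∑ m, ∑ i, S m i * Hc i m j) ^ 2 ≤ n2 * (M ^ 2 * (G2 - n2 / 3)) := by
    calc (∑ j, w j * ∑ m, ∑ i, S m i * Hc i m j) ^ 2
        ≤ (∑ j, w j ^ 2) * ∑ j, (∑ m, ∑ i, S m i * Hc i m j) ^ 2 :=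
          Finset.sum_mul_sq_le_sq_mul_sq _ _ _
      _ ≤ n2 * (M ^ 2 * (G2 - n2 / 3)) := by
          rw [← hn2]
          have hn20 : 0 ≤ n2 := Finset.sum_nonneg fun _ _ => sq_nonneg _
          refine mul_le_mul_of_nonneg_left (hsumc.trans ?_) hn20
          exact mul_le_mul_of_nonneg_right hS hD0
  -- `2√(n2 · M² D) ≤ M (t n2 + D/t)`, `t = √6/3`
  have h6 : Real.sqrt 6 ^ 2 = 6 := Real.sq_sqrt (by norm_num)
  have hn20 : 0 ≤ n2 := Finset.sum_nonneg fun _ _ => sq_nonneg _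
  set D := G2 - n2 / 3 with hD
  have hb0 : 0 ≤ M / 2 * (Real.sqrt 6 / 3 * n2 + Real.sqrt 6 / 2 * D) := by positivity
  have hsq : (∑ j, w j * ∑ m, ∑ i, S m i * Hc i m j) ^ 2 ≤
      (M / 2 * (Real.sqrt 6 / 3 * n2 + Real.sqrt 6 / 2 * D)) ^ 2 := by
    have hexp : (M / 2 * (Real.sqrt 6 / 3 * n2 + Real.sqrt 6 / 2 * D)) ^ 2 =
        M ^ 2 / 4 * (2 / 3 * n2 ^ 2 + 2 * n2 * D + 3 / 2 * D ^ 2) := by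
      have : Real.sqrt 6 / 3 * n2 + Real.sqrt 6 / 2 * D = Real.sqrt 6 * (n2 / 3 + D / 2) := by ring
      rw [this, mul_pow, mul_pow, h6]; ring
    rw [hexp]
    nlinarith [hP, mul_nonneg (sq_nonneg M) (sq_nonneg (n2 - 3 / 2 * D))]
  have habs := abs_le_of_sq_le_sq hsq hb0
  calc 2 * |∑ j, w j * ∑ m, ∑ i, S m i * Hc i m j|
      ≤ 2 * (M / 2 * (Real.sqrt 6 / 3 * n2 + Real.sqrt 6 / 2 * D)) := by linarith
    _ = M * (Real.sqrt 6 / 3 * n2 + Real.sqrt 6 / 2 * D) := by ring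

omit [DecidableEq d] in
/-- The strain Frobenius norm is at most the gradient Frobenius norm:
`Σᵢⱼ ((Rⱼᵢ + Rᵢⱼ)/2)² ≤ Σᵢⱼ Rᵢⱼ²`. [folklore] -/
theorem sum_symm_sq_le (R : d → d → ℝ) :
    ∑ i, ∑ j, ((R j i + R i j) / 2) ^ 2 ≤ ∑ i, ∑ j, R i j ^ 2 := by
  have h : ∀ i j, ((R j i + R i j) / 2) ^ 2 ≤ (R j i ^ 2 + R i j ^ 2) / 2 := fun i j => by
    nlinarith [sq_nonneg (R j i - R i j)]
  calc ∑ i, ∑ j, ((R j i + R i j) / 2) ^ 2 ≤ ∑ i, ∑ j, (R j i ^ 2 + R i j ^ 2) / 2 :=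
        Finset.sum_le_sum fun i _ => Finset.sum_le_sum fun j _ => h i j
    _ = ((∑ i, ∑ j, R j i ^ 2) + ∑ i, ∑ j, R i j ^ 2) / 2 := by
        rw [← Finset.sum_add_distrib, Finset.sum_div]
        refine Finset.sum_congr rfl fun i _ => ?_
        rw [← Finset.sum_add_distrib, Finset.sum_div]
    _ = ∑ i, ∑ j, R i j ^ 2 := by rw [Finset.sum_comm]; ring

end StrainTransport

/-! ## The two surviving Leibniz pieces, pointwise, in strain currency -/

/-- The trace of the strain is the divergence: `Σᵢ Sᵢᵢ = div v = 0`. [folklore] -/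
theorem sum_strain_diag_eq_zero {v : UnitAddTorus d → EuclideanSpace ℝ d} (hv : Torus.IsSmooth v)
    (hdiv : Torus.IsDivFree v) (x : UnitAddTorus d) :
    ∑ i, (Torus.partialDeriv i v x i + Torus.partialDeriv i v x i) / 2 = 0 := by
  have h2 := Torus.divergence_eq_sum_partialDeriv_apply (hv.isContDiff (by simp)) x
  have : ∑ i, (Torus.partialDeriv i v x i + Torus.partialDeriv i v x i) / 2 =
      ∑ i, Torus.partialDeriv i v x i := Finset.sum_congr rfl fun i _ => by ring
  rw [this, ← h2]
  exact hdiv x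

/-- **`P₃` pointwise**: `|⟪(Δv·∇)v, Δv⟫(x)| ≤ (√6/3) · M · ‖Δv(x)‖²` when `|S(x)|_F² ≤ M²`
(`ΔvᵀSΔv`, deviatoric Cauchy–Schwarz, `tr S = 0`). [folklore] -/
theorem abs_inner_convect_laplacian_le (hd : Fintype.card d = 3)
    {v : UnitAddTorus d → EuclideanSpace ℝ d} (hv : Torus.IsSmooth v) (hdiv : Torus.IsDivFree v)
    {M : ℝ} (hM : 0 ≤ M) (x : UnitAddTorus d)
    (hSx : ∑ i, ∑ j, ((Torus.partialDeriv j v x i + Torus.partialDeriv i v x j) / 2) ^ 2 ≤ M ^ 2) :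
    |⟪Torus.convect (Torus.laplacian v) v x, Torus.laplacian v x⟫_ℝ| ≤
      Real.sqrt 6 / 3 * M * ‖Torus.laplacian v x‖ ^ 2 := by
  have hv1 : Torus.IsContDiff 1 v := hv.isContDiff (by simp)
  have htr : ∑ i, (fun i j => (Torus.partialDeriv j v x i + Torus.partialDeriv i v x j) / 2) i i = 0 :=
    sum_strain_diag_eq_zero hv hdiv x
  have hin : ∀ i, ⟪Torus.partialDeriv i v x, Torus.laplacian v x⟫_ℝ =
      ∑ j, Torus.partialDeriv i v x j * Torus.laplacian v x j := by
    intro i; simp [PiLp.inner_apply, mul_comm]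
  have hQ : ⟪Torus.convect (Torus.laplacian v) v x, Torus.laplacian v x⟫_ℝ =
      ∑ i, ∑ j, (Torus.partialDeriv j v x i + Torus.partialDeriv i v x j) / 2 *
        (Torus.laplacian v x i * Torus.laplacian v x j) := by
    rw [Torus.convect_eq_sum_smul_partialDeriv hv1 x, sum_inner]
    simp_rw [real_inner_smul_left, hin, Finset.mul_sum]
    have hsym : ∑ i, ∑ j, Torus.laplacian v x i * (Torus.partialDeriv i v x j * Torus.laplacian v x j) =
        ∑ i, ∑ j, Torus.laplacian v x i * (Torus.partialDeriv j v x i * Torus.laplacian v x j) := by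
      rw [Finset.sum_comm]
      exact Finset.sum_congr rfl fun i _ => Finset.sum_congr rfl fun j _ => by ring
    have hsplit : ∑ i, ∑ j, (Torus.partialDeriv j v x i + Torus.partialDeriv i v x j) / 2 *
        (Torus.laplacian v x i * Torus.laplacian v x j) =
        ((∑ i, ∑ j, Torus.laplacian v x i * (Torus.partialDeriv j v x i * Torus.laplacian v x j)) +
          ∑ i, ∑ j, Torus.laplacian v x i * (Torus.partialDeriv i v x j * Torus.laplacian v x j)) / 2 := by
      rw [← Finset.sum_add_distrib, Finset.sum_div]
      refine Finset.sum_congr rfl fun i _ => ?_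
      rw [← Finset.sum_add_distrib, Finset.sum_div]
      exact Finset.sum_congr rfl fun j _ => by ring
    rw [hsplit, ← hsym]
    ring
  rw [hQ]
  have key := StrainTransport.abs_quadForm_le hd _ htr (fun i => Torus.laplacian v x i) hM hSx
  have hn : ‖Torus.laplacian v x‖ ^ 2 = ∑ i, Torus.laplacian v x i ^ 2 := by
    rw [EuclideanSpace.norm_sq_eq]
    exact Finset.sum_congr rfl fun i _ => by rw [Real.norm_eq_abs, sq_abs]
  rw [hn]
  exact key

/-- **`P₂` pointwise**: `2|Σₘ⟪(∂ₘv·∇)∂ₘv, Δv⟫(x)| ≤ M((√6/3)‖Δv‖² + (√6/2)(Σₘᵢ‖∂ᵢ∂ₘv‖² − ‖Δv‖²/3))`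
when `|S(x)|_F² ≤ M²` (Hessians symmetric ⇒ only `S` survives; deviatoric Cauchy–Schwarz per
component; `tr ∇²vⱼ = Δvⱼ`). [folklore] -/
theorem two_mul_abs_sum_inner_convect_partialDeriv_le (hd : Fintype.card d = 3)
    {v : UnitAddTorus d → EuclideanSpace ℝ d} (hv : Torus.IsSmooth v) (hdiv : Torus.IsDivFree v)
    {M : ℝ} (hM : 0 ≤ M) (x : UnitAddTorus d)
    (hSx : ∑ i, ∑ j, ((Torus.partialDeriv j v x i + Torus.partialDeriv i v x j) / 2) ^ 2 ≤ M ^ 2) :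
    2 * |∑ m, ⟪Torus.convect (Torus.partialDeriv m v) (Torus.partialDeriv m v) x,
        Torus.laplacian v x⟫_ℝ| ≤
      M * (Real.sqrt 6 / 3 * ‖Torus.laplacian v x‖ ^ 2 +
        Real.sqrt 6 / 2 * ((∑ m, ∑ i, ‖Torus.partialDeriv i (Torus.partialDeriv m v) x‖ ^ 2) -
          ‖Torus.laplacian v x‖ ^ 2 / 3)) := by
  have hD1 : ∀ m, Torus.IsContDiff 1 (Torus.partialDeriv m v) := fun m =>
    (hv.partialDeriv m).isContDiff (by simp)
  have htr : ∑ i, (fun i j => (Torus.partialDeriv j v x i + Torus.partialDeriv i v x j) / 2) i i = 0 :=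
    sum_strain_diag_eq_zero hv hdiv x
  -- abbreviations (as plain functions, for the algebraic lemma)
  set w : d → ℝ := fun j => Torus.laplacian v x j with hw
  set Hc : d → d → d → ℝ := fun i m j => Torus.partialDeriv i (Torus.partialDeriv m v) x j with hHc
  set S : d → d → ℝ := fun i j => (Torus.partialDeriv j v x i + Torus.partialDeriv i v x j) / 2 with hS
  -- symmetric Hessians
  have hΦsym : ∀ i m, ⟪Torus.partialDeriv i (Torus.partialDeriv m v) x, Torus.laplacian v x⟫_ℝ =
      ⟪Torus.partialDeriv m (Torus.partialDeriv i v) x, Torus.laplacian v x⟫_ℝ := fun i m => by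
    rw [Torus.partialDeriv_comm hv i m x]
  -- step 1: expand the convective derivatives
  have step1 : ∑ m, ⟪Torus.convect (Torus.partialDeriv m v) (Torus.partialDeriv m v) x,
      Torus.laplacian v x⟫_ℝ =
      ∑ m, ∑ i, Torus.partialDeriv m v x i *
        ⟪Torus.partialDeriv i (Torus.partialDeriv m v) x, Torus.laplacian v x⟫_ℝ := by
    refine Finset.sum_congr rfl fun m _ => ?_
    rw [Torus.convect_eq_sum_smul_partialDeriv (hD1 m) x, sum_inner]
    simp_rw [real_inner_smul_left]
  -- step 2: symmetrise in `(m, i)` — only the strain survives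
  have step2 : ∑ m, ∑ i, Torus.partialDeriv m v x i *
        ⟪Torus.partialDeriv i (Torus.partialDeriv m v) x, Torus.laplacian v x⟫_ℝ =
      ∑ m, ∑ i, S m i *
        ⟪Torus.partialDeriv i (Torus.partialDeriv m v) x, Torus.laplacian v x⟫_ℝ := by
    have hsw : ∑ m, ∑ i, Torus.partialDeriv m v x i *
          ⟪Torus.partialDeriv i (Torus.partialDeriv m v) x, Torus.laplacian v x⟫_ℝ =
        ∑ m, ∑ i, Torus.partialDeriv i v x m *
          ⟪Torus.partialDeriv i (Torus.partialDeriv m v) x, Torus.laplacian v x⟫_ℝ := by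
      rw [Finset.sum_comm]
      exact Finset.sum_congr rfl fun m _ => Finset.sum_congr rfl fun i _ => by rw [hΦsym i m]
    have hsplit : ∑ m, ∑ i, S m i *
          ⟪Torus.partialDeriv i (Torus.partialDeriv m v) x, Torus.laplacian v x⟫_ℝ =
        ((∑ m, ∑ i, Torus.partialDeriv i v x m *
            ⟪Torus.partialDeriv i (Torus.partialDeriv m v) x, Torus.laplacian v x⟫_ℝ) +
          ∑ m, ∑ i, Torus.partialDeriv m v x i *
            ⟪Torus.partialDeriv i (Torus.partialDeriv m v) x, Torus.laplacian v x⟫_ℝ) / 2 := by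
      rw [← Finset.sum_add_distrib, Finset.sum_div]
      refine Finset.sum_congr rfl fun m _ => ?_
      rw [← Finset.sum_add_distrib, Finset.sum_div]
      exact Finset.sum_congr rfl fun i _ => by rw [hS]; ring
    rw [hsplit, ← hsw]
    ring
  -- step 3: expand the inner products and bring `j` outside
  have hin : ∀ i m, ⟪Torus.partialDeriv i (Torus.partialDeriv m v) x, Torus.laplacian v x⟫_ℝ =
      ∑ j, Hc i m j * w j := fun i m => by
    simp [hHc, hw, PiLp.inner_apply, mul_comm]
  have step3 : ∑ m, ∑ i, S m i *
        ⟪Torus.partialDeriv i (Torus.partialDeriv m v) x, Torus.laplacian v x⟫_ℝ =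
      ∑ j, w j * ∑ m, ∑ i, S m i * Hc i m j := by
    simp_rw [hin, Finset.mul_sum]
    have e1 : ∑ m, ∑ i, ∑ j, S m i * (Hc i m j * w j) = ∑ m, ∑ j, ∑ i, S m i * (Hc i m j * w j) :=
      Finset.sum_congr rfl fun m _ => Finset.sum_comm
    rw [e1, Finset.sum_comm]
    exact Finset.sum_congr rfl fun j _ => Finset.sum_congr rfl fun m _ =>
      Finset.sum_congr rfl fun i _ => by ring
  -- the traces of the Hessians are the components of `Δv`
  have hlap : ∀ j, ∑ m, Hc m m j = w j := by
    intro j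
    simp only [hHc, hw]
    rw [Torus.laplacian_eq_sum_partialDeriv_partialDeriv hv x]
    simp [Finset.sum_apply]
  have key := StrainTransport.two_mul_abs_bilin_le hd S htr Hc w hlap hM hSx
  -- translate norms
  have hn : ‖Torus.laplacian v x‖ ^ 2 = ∑ j, w j ^ 2 := by
    rw [EuclideanSpace.norm_sq_eq]
    exact Finset.sum_congr rfl fun j _ => by rw [Real.norm_eq_abs, sq_abs]
  have hG : ∑ m, ∑ i, ‖Torus.partialDeriv i (Torus.partialDeriv m v) x‖ ^ 2 =
      ∑ m, ∑ i, ∑ j, Hc i m j ^ 2 := by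
    refine Finset.sum_congr rfl fun m _ => Finset.sum_congr rfl fun i _ => ?_
    rw [EuclideanSpace.norm_sq_eq]
    exact Finset.sum_congr rfl fun j _ => by rw [Real.norm_eq_abs, sq_abs]
  rw [step1, step2, step3, hn, hG]
  exact key

end Summit.NavierStokesRegularity.FunctionalMining

end
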